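import Literature.AlgebraicGeometry.AbelianSchemes.IdealTorsionGenericFibreEtale
import Literature.AlgebraicGeometry.GroupSchemes.AffineGroupSchemeIsoSpec
import Mathlib.RingTheory.LocalRing.Module
import HarnessLib

/-!
# A finite flat scheme over a local ring is `Spec` of a finite FREE algebra; a finite flat group scheme over a
# local ring is `Spec` of a finite free commutative Hopf algebra

Topic `Literature/AlgebraicGeometry/GroupSchemes`, namespace `Literature.AlgebraicGeometry.GroupSchemes.AffineGroupScheme`
(continues ★ `AffineGroupSchemeHopfAlgebra`: the carrier `Alg Z = Γ(Z, 𝒪_Z)` with its `R`-algebra structure, `Alg.moduleFinite`,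
`Alg.instHopfAlgebra`, and ★ `Alg.moduleFlat_of_flat`). THEOREMS ONLY (no definition, no instance, no named fact).

THE PRINT. [StacksProject, Tag 00NZ]: a finite flat module over a local ring is free (Mathlib
`Module.free_of_flat_of_isLocalRing`, no finite presentation needed). [GortzWedhorn2023] §(27.2), (27.2.1), Def. 27.6
(pp. 606–607): an affine group scheme `G = Spec A` over `R` is the same as a commutative Hopf `R`-algebra `A`. Hence a FINITE
FLAT group scheme `Z → Spec R` over a LOCAL ring `R` is `Spec H` for a commutative Hopf algebra `H = Γ(Z, 𝒪_Z)` which is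
finite and free as an `R`-module — the currency `[Module.Free R H] [Module.Finite R H]` of the tree's affine torsor-quotient
sheet (★ `GroupSchemes/FiniteFlatGroupSchemeQuotientAffine*`) and of Cartier duality (★ `GroupSchemes/CartierDual*`).

* §1 `Alg.moduleFree_of_flat` — `Z → Spec R` finite and flat, `R` local ⟹ `Γ(Z, 𝒪_Z)` is a free `R`-module (with the ★
  finiteness and flatness of `Alg Z`); `isAffine_and_moduleFinite_and_moduleFree` packages `IsAffine Z ∧ Module.Finite ∧ Module.Free`.
* §2 `exists_hopf_presentation_of_isFinite_of_flat` — for a finite flat GROUP scheme `Z` over a local ring: `Γ(Z, 𝒪_Z)` is a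
  finite free `R`-module and the canonical `Z ≅ Spec Γ(Z, 𝒪_Z)` (★ `isoSpecOver`) is an isomorphism of group schemes when
  `Spec Γ(Z, 𝒪_Z)` carries the group structure of the Hopf algebra `Γ(Z, 𝒪_Z)` (★ `isMonHom_isoSpecOver_hom`).

## References
* [StacksProject] The Stacks Project, Tag 00NZ (finite flat modules over a local ring are free).
* [GortzWedhorn2023] U. Görtz, T. Wedhorn, *Algebraic Geometry II* (2023), §(27.2), (27.2.1), Def. 27.6 (pp. 606–607).
-/

noncomputable section

universe u

open CategoryTheory AlgebraicGeometry

namespace Literature.AlgebraicGeometry.GroupSchemes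

namespace AffineGroupScheme

open Literature.AlgebraicGeometry.Motives

variable {R : Type u} [CommRing R]

/-! ## §1 Finite flat over a local ring ⟹ `Γ(Z, 𝒪_Z)` is finite free -/

/-- **A finite flat scheme over a local ring has a FREE affine algebra**: if `Z → Spec R` is finite and flat and `R` is local,
then `Γ(Z, 𝒪_Z)` is a free `R`-module (it is finite by ★ `Alg.moduleFinite` and flat by ★ `Alg.moduleFlat_of_flat`, `Z` being
affine; a finite flat module over a local ring is free). [cite: StacksProject, Tag 00NZ]
[cite: GortzWedhorn2023, §(27.2) (p. 606)] -/
theorem Alg.moduleFree_of_flat [IsLocalRing R] (Z : SchemeOver R) [IsFinite Z.hom] [Flat Z.hom] :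
    Module.Free R (Alg Z) := by
  haveI : IsAffine Z.left := isAffine_left_of_isAffineHom Z
  haveI : Module.Finite R (Alg Z) := Alg.moduleFinite Z
  haveI : Module.Flat R (Alg Z) := Alg.moduleFlat_of_flat Z
  exact Module.free_of_flat_of_isLocalRing

/-- **Package**: a finite flat `Z → Spec R` over a local ring is affine with `Γ(Z, 𝒪_Z)` a finite free `R`-module — the three
hypotheses `IsAffine`, `Module.Finite R H`, `Module.Free R H` (at `H := Alg Z`) under which the tree's affine quotient and
Cartier-duality sheets are stated. [cite: StacksProject, Tag 00NZ] [cite: GortzWedhorn2023, §(27.2) (p. 606)] -/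
theorem isAffine_and_moduleFinite_and_moduleFree [IsLocalRing R] (Z : SchemeOver R) [IsFinite Z.hom] [Flat Z.hom] :
    IsAffine Z.left ∧ Module.Finite R (Alg Z) ∧ Module.Free R (Alg Z) :=
  ⟨isAffine_left_of_isAffineHom Z, Alg.moduleFinite Z, Alg.moduleFree_of_flat Z⟩

/-! ## §2 Finite flat GROUP schemes over a local ring: `Z ≅ Spec H`, `H` a finite free commutative Hopf algebra -/

open scoped MonObj in
/-- **The Hopf presentation of a finite flat group scheme over a local ring** ([GortzWedhorn2023] §(27.2), Def. 27.6 with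
[StacksProject 00NZ]): for a group object `Z` of `Over (Spec R)` with `Z → Spec R` finite and flat and `R` local, the affine
algebra `H := Γ(Z, 𝒪_Z)` (★ `Alg Z`, a commutative Hopf `R`-algebra by ★ `Alg.instHopfAlgebra`) is a finite free `R`-module, and
the canonical isomorphism `Z ≅ Spec H` over `Spec R` (★ `isoSpecOver Z`) is an isomorphism of GROUP schemes for the group structure
of `Spec H` defined by the Hopf algebra `H` (★ `grpObjOfHopfAlgebra`, ★ `isMonHom_isoSpecOver_hom`).
[cite: GortzWedhorn2023, §(27.2) (27.2.1) and Def. 27.6 (pp. 606–607)] [cite: StacksProject, Tag 00NZ] -/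
theorem exists_hopf_presentation_of_isFinite_of_flat [IsLocalRing R] (Z : SchemeOver R) [GrpObj Z] [IsFinite Z.hom]
    [Flat Z.hom] :
    Module.Finite R (Alg Z) ∧ Module.Free R (Alg Z) ∧
      ∃ (_ : IsAffine Z.left) (e : Z ≅ Literature.AlgebraicGeometry.Motives.specOver R (Alg Z)),
        e = isoSpecOver Z ∧ (letI := grpObjOfHopfAlgebra R (Alg Z); IsMonHom e.hom) := by
  haveI : IsAffine Z.left := isAffine_left_of_isAffineHom Z
  exact ⟨Alg.moduleFinite Z, Alg.moduleFree_of_flat Z, ‹IsAffine Z.left›, isoSpecOver Z, rfl,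
    isMonHom_isoSpecOver_hom Z⟩

end AffineGroupScheme

end Literature.AlgebraicGeometry.GroupSchemes

end
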